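import Summits.QuantumFields.YangMills.Theorems.BalabanUVNodesPortS1ChartBlind
import Summits.QuantumFields.YangMills.Theorems.BalabanUVNodesN09PerBondChartsOfForwardLawsSharp
import Summits.QuantumFields.YangMills.Theorems.BalabanUVNodesN09CentralWindowForwardLawAtRecord

/-!
# NODE O port PT-A — FE-1's chart law (T1), brick (B-γ2♯)∕(B-d′)₀ of `Lines/pta_residueW-CHART-LAW-PROOF-PLAN-v1.md` §2: THE SHARP PER-BOND BUNDLE (density FORMULA `jd = (jac ∘ ϑ)⁻¹`,
# continuity, compact image windows) TAKEN BLIND TO THE PRIVATE COORDINATES, and — at the record — with N09's PROVED forward Jacobian laws plugged in: an EXPLICIT-DENSITY, CONTINUOUS,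
# BLIND chart of the averaging of record on the central α-window, nothing displayed

Cell `ym-nodeO-ideate`, porter seat PT-A-1 (gen 10); `--kind proof --supports stmt-QuantumFields-27930 --as helper`; count-neutral.  [I] = [Balaban1987RG1].
Over ✓`…PortS1ChartBlind` ((B-γ2): resampling algebra, `avg_update_centralBond_extend`), dag-n09-w6 ✓`…N09PerBondChartsOfForwardLawsSharp.exists_perBondCharts_of_forwardLaws_sharp` (the
sixteen-clause sharp packaging from a forward law `(jac, hjacm, hjac0, hfwd)`), ✓`…N09CentralWindowInverseContinuous` ((C1)–(C4) from `T = image` + left inverse, by name), dag-n09-w4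
✓`…N09CentralWindowForwardLawAtRecord.exists_jacobian_forwardLaws_continuousOn` ((F) DISCHARGED: the forward laws with jointly measurable densities, positive and CONTINUOUS on the windows).

WHY (located in ✓`…PortS1ChartBlind`'s bus line, (B-d′)): the fibre formula reads the inverse density `jd_c(U, v)` AT THE POINT `v = V c`; a Radon–Nikodym version says nothing there, a
density given by a FORMULA through a continuous forward density does.  The sharp packaging has the formula; this file makes it blind (pre-composition with `U ↦ extend β 1 U`, the
forward density INCLUDED: `jac′_c(U) := jac_c(extend β 1 U)` is again a forward density because the window and the one-variable map are blind) and plugs N09's proved `jac`.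

WHAT IS PROVED (0 `def`).
* §1 `centralWindow_mem_iff_extend` (window membership is blind), `forwardLaw_extend` (a forward law at `extend β g U` is a forward law at `U`), `continuous_extend_const`.
* §2 ★★★ `exists_blindSharpPerBondCharts_centralWindow` — from `(jac; hjacm, hjac0, hfwd, hjacc)` on the central α-window (`k < K`, `0 ≤ α ≤ 1∕24`, `α < δ_N`, `offCard∕|Idx| + 150α < 1`):
  `∃ T ϑ jd jac′` with: joint measurability ×3; right inverse; inverse law; `T = image`; left inverse; `ϑ ∈ window`; (Q) `jd_c(U,v) = (jac′_c(U, ϑ_c(U,v)))⁻¹`; (P) `jd ≠ 0` on `T`; `jac′` jointly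
  measurable, `≠ 0` and continuous on the window, with the forward law; (C1)–(C4); `jd_c(U,·)` continuous on `T_c(U)`; AND `T ∕ ϑ ∕ jd ∕ jac′` BLIND: `•_c(extend β g U) = •_c(U)`.
* §3 ★★★ `exists_blindSharpPerBondCharts_centralWindow_record` — the same with NO forward-law input (`64α ≤ δ_N`, `157α < L^{−(d−1)}` added: dag-n09-w4's (F)).

HONEST FRAMING.  Packaging by name (pre-composition with a measurable∕continuous resampling; N09's theorems VERBATIM); the density is N09's log-chart Jacobian read through `ϑ` — its
identification with print's `Π_b chartJac ∕ |det ∂_{b₀}Q̃|` in DEF-1's Pauli coordinates ((B-d′) proper) is NOT here; (B-e)∕(B-★)∕(B-T2) NOT here; nothing of (2.10)–(2.14)'s estimates;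
`FEChartLawStep`∕`FEStepBox` inhabited nowhere; `stub_P0C`∕`stub_FEstep` OPEN; ⟨27930⟩ OPEN 1∕3; N09∕N11∕K1 untouched; NODE O 0∕1; COUNT 8∕28 · K 1∕4 UNMOVED; finite `𝕋⁴_{L^K}` at fixed ε —
NOT continuum ∕ OS; **the Yang–Mills mass gap (Clay) is NOT proved by any of this.**  No `sorry`, no `def`, no `instance`; standard axioms only.
-/

noncomputable section

open MeasureTheory ProbabilityTheory Set Function Filter Topology
open scoped ENNReal NNReal BigOperators

namespace Summit.QuantumFields.YangMills.Theorems.BalabanUVNodesPortS1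

open Literature.MathematicalPhysics.QuantumFieldTheory.Balaban1983to89
open Literature.MathematicalPhysics.QuantumFieldTheory.Balaban1983to89.T4AveragingDisintegration
open Literature.MathematicalPhysics.QuantumFieldTheory.Balaban1983to89.BlockAveraging (Small Idx avgFun loopHol)
open Literature.MathematicalPhysics.QuantumFieldTheory.Balaban1983to89.BlockAveragingHaarAC (centralBond pre post centralBond_injective isLocal_avgFun)
open Literature.MathematicalPhysics.QuantumFieldTheory.Balaban1983to89.BlockAveragingEMLHaarAC (fibreFamily offCard)
open Literature.MathematicalPhysics.QuantumFieldTheory.Balaban1983to89.ExpMeanLog (expMeanLogSU deltaSU)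
open Summit.QuantumFields.YangMills.Theorems.BalabanUVNodesN11TransportOfRecordInPrivateCoordinateChart (succ_le_m_add_K)
open Summit.QuantumFields.YangMills.BalabanUVNodes.N09CentralWindowAtRecord (measurableSet_centralWindow centralWindow_extend avgFun_update_centralBond_injOn_centralWindow)
open Summit.QuantumFields.YangMills.BalabanUVNodes.N09PerBondChartsOfForwardLawsSharp (exists_perBondCharts_of_forwardLaws_sharp continuousOn_inverseDensity_of_formula)
open Summit.QuantumFields.YangMills.BalabanUVNodes.N09CentralWindowInverseContinuous
  (isClosed_imageWindowGraph_record continuousOn_inverse_of_leftInverse_record continuousOn_triChart_of_leftInverse_record isCompact_imageWindow_record)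
open Summit.QuantumFields.YangMills.BalabanUVNodes.N09CentralWindowForwardLawAtRecord (exists_jacobian_forwardLaws_continuousOn)
open Node00 hiding SU
open T4Continuum

/-! ## §1  Window membership and forward laws are blind to the private coordinates -/

section Blind

variable {ι κ G : Type*}

/-- Resampling with a fixed private datum is continuous (coordinatewise a projection or a constant). [folklore] -/
theorem continuous_extend_const [TopologicalSpace G] {β : κ → ι} (hβ : Injective β) (g : κ → G) :
    Continuous fun U : ι → G => extend β g U := by
  refine continuous_pi fun i => ?_
  by_cases h : ∃ c, β c = i
  · obtain ⟨c, rfl⟩ := h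
    simp only [hβ.extend_apply]
    exact continuous_const
  · simp only [extend_apply' _ _ _ h]
    exact continuous_apply i

variable {F : T4Family} {N : ℕ} [NeZero N] {K k : ℕ}

/-- Central-window membership is blind to the private coordinates (dag-n09-w6's `centralWindow_extend`, as an `iff`). [cite: Balaban1987RG1, (0.4) p.253, (2.9) p.266] -/
theorem centralWindow_mem_iff_extend (hk : k < K) (c : PBond (F.P K) (k + 1)) (α : ℝ) (U : GaugeField (F.P K) k (SU N)) (g' : PBond (F.P K) (k + 1) → SU N) (g : SU N) :
    (∀ i : Idx (F.P K), dist1 (fibreFamily (extend centralBond g' U) c (pre (extend centralBond g' U) c * g * post (extend centralBond g' U) c) i) ≤ α) ↔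
      ∀ i : Idx (F.P K), dist1 (fibreFamily U c (pre U c * g * post U c) i) ≤ α := by
  have h := centralWindow_extend (N := N) (succ_le_m_add_K hk) c α U g'
  exact Set.ext_iff.1 h g

omit [NeZero N] in
/-- The one-variable map at `extend β g U` IS the one-variable map at `U` (as functions). [cite: Balaban1987RG1, (0.4) p.253] -/
theorem oneVariable_extend_eq [NeZero N] (hk : k < K) (c : PBond (F.P K) (k + 1)) (U : GaugeField (F.P K) k (SU N)) (g' : PBond (F.P K) (k + 1) → SU N) :
    (fun g : SU N => (avOfRecord F N K k).avg (update (extend centralBond g' U) (centralBond c) g) c) =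
      fun g : SU N => (avOfRecord F N K k).avg (update U (centralBond c) g) c :=
  funext fun g => avg_update_centralBond_extend hk U c g' g

/-- ★ **A FORWARD LAW AT `extend β g′ U` IS A FORWARD LAW AT `U`** with the density read at `extend β g′ U`. [cite: Balaban1987RG1, (0.4) p.253 and (2.10) p.267] -/
theorem forwardLaw_extend (hk : k < K) {α : ℝ} (jac : PBond (F.P K) (k + 1) → GaugeField (F.P K) k (SU N) → SU N → ℝ≥0)
    (hfwd : ∀ c U, (HaarData.haar : Measure (SU N)).restrict
        ((fun g => (avOfRecord F N K k).avg (update U (centralBond c) g) c) ''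
          {g : SU N | ∀ i : Idx (F.P K), dist1 (fibreFamily U c (pre U c * g * post U c) i) ≤ α}) =
      (((HaarData.haar : Measure (SU N)).restrict {g : SU N | ∀ i : Idx (F.P K), dist1 (fibreFamily U c (pre U c * g * post U c) i) ≤ α}).withDensity
          fun g => (jac c U g : ℝ≥0∞)).map (fun g => (avOfRecord F N K k).avg (update U (centralBond c) g) c))
    (c : PBond (F.P K) (k + 1)) (U : GaugeField (F.P K) k (SU N)) (g' : PBond (F.P K) (k + 1) → SU N) :
    (HaarData.haar : Measure (SU N)).restrict
        ((fun g => (avOfRecord F N K k).avg (update U (centralBond c) g) c) ''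
          {g : SU N | ∀ i : Idx (F.P K), dist1 (fibreFamily U c (pre U c * g * post U c) i) ≤ α}) =
      (((HaarData.haar : Measure (SU N)).restrict {g : SU N | ∀ i : Idx (F.P K), dist1 (fibreFamily U c (pre U c * g * post U c) i) ≤ α}).withDensity
          fun g => (jac c (extend centralBond g' U) g : ℝ≥0∞)).map (fun g => (avOfRecord F N K k).avg (update U (centralBond c) g) c) := by
  have h := hfwd c (extend centralBond g' U)
  rw [oneVariable_extend_eq hk c U g', centralWindow_extend (N := N) (succ_le_m_add_K hk) c α U g'] at h
  exact h

end Blind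

/-! ## §2  The blind sharp bundle from a forward law -/

section Sharp

variable {F : T4Family} {N : ℕ} [NeZero N] {K k : ℕ}

/-- ★★★ **THE SHARP PER-BOND BUNDLE, BLIND TO THE PRIVATE COORDINATES, FROM A FORWARD JACOBIAN LAW ON THE CENTRAL α-WINDOW** (`k < K`, `0 ≤ α ≤ 1∕24`, `α < δ_N`,
`offCard∕|Idx| + 150α < 1`; input `(jac; hjacm, hjac0, hfwd, hjacc)`).  Output `(T, ϑ, jd, jac′)`: dag-n09-w6's sharp clauses (measurability ×3, right inverse, inverse law, `T = image`, left
inverse, `ϑ ∈ window`, (Q) `jd = (jac′ ∘ ϑ)⁻¹`, (P), (C1)–(C4)), the forward-law clauses and window-continuity of `jac′`, continuity of `jd_c(U,·)` on `T_c(U)`, AND blindness of all four.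
[cite: Balaban1987RG1, p.259, (0.4) p.253, (2.9)–(2.10) pp.266–267; Kechris1995, Thm 15.1; BourbakiGT1, Ch. I §10 no. 2, Thm 1 Cor. 5] -/
theorem exists_blindSharpPerBondCharts_centralWindow (hk : k < K) {α : ℝ} (hα0 : 0 ≤ α) (hα : α ≤ 1 / 24)
    (hαδ : α < deltaSU (Fin N)) (hgap : ∀ c : PBond (F.P K) (k + 1), (offCard c : ℝ) / (Fintype.card (Idx (F.P K)) : ℝ) + 150 * α < 1)
    (jac : PBond (F.P K) (k + 1) → GaugeField (F.P K) k (SU N) → SU N → ℝ≥0)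
    (hjacm : ∀ c, Measurable fun p : GaugeField (F.P K) k (SU N) × SU N => jac c p.1 p.2)
    (hjac0 : ∀ c U g, (∀ i : Idx (F.P K), dist1 (fibreFamily U c (pre U c * g * post U c) i) ≤ α) → jac c U g ≠ 0)
    (hfwd : ∀ c U, (HaarData.haar : Measure (SU N)).restrict
        ((fun g => (avOfRecord F N K k).avg (update U (centralBond c) g) c) ''
          {g : SU N | ∀ i : Idx (F.P K), dist1 (fibreFamily U c (pre U c * g * post U c) i) ≤ α}) =
      (((HaarData.haar : Measure (SU N)).restrict {g : SU N | ∀ i : Idx (F.P K), dist1 (fibreFamily U c (pre U c * g * post U c) i) ≤ α}).withDensity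
          fun g => (jac c U g : ℝ≥0∞)).map (fun g => (avOfRecord F N K k).avg (update U (centralBond c) g) c))
    (hjacc : ∀ c U, ContinuousOn (jac c U) {g : SU N | ∀ i : Idx (F.P K), dist1 (fibreFamily U c (pre U c * g * post U c) i) ≤ α}) :
    ∃ (T : PBond (F.P K) (k + 1) → GaugeField (F.P K) k (SU N) → Set (SU N))
      (ϑ : PBond (F.P K) (k + 1) → GaugeField (F.P K) k (SU N) → SU N → SU N)
      (jd jac' : PBond (F.P K) (k + 1) → GaugeField (F.P K) k (SU N) → SU N → ℝ≥0),
      (∀ c, MeasurableSet {p : GaugeField (F.P K) k (SU N) × SU N | p.2 ∈ T c p.1}) ∧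
      (∀ c, Measurable fun p : GaugeField (F.P K) k (SU N) × SU N => ϑ c p.1 p.2) ∧
      (∀ c, Measurable fun p : GaugeField (F.P K) k (SU N) × SU N => jd c p.1 p.2) ∧
      (∀ c U, ∀ v ∈ T c U, (avOfRecord F N K k).avg (update U (centralBond c) (ϑ c U v)) c = v) ∧
      (∀ c U, (HaarData.haar : Measure (SU N)).restrict {g : SU N | ∀ i : Idx (F.P K), dist1 (fibreFamily U c (pre U c * g * post U c) i) ≤ α} =
        (((HaarData.haar : Measure (SU N)).restrict (T c U)).withDensity fun v => (jd c U v : ℝ≥0∞)).map (ϑ c U)) ∧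
      (∀ c U, T c U = (fun g => (avOfRecord F N K k).avg (update U (centralBond c) g) c) ''
          {g : SU N | ∀ i : Idx (F.P K), dist1 (fibreFamily U c (pre U c * g * post U c) i) ≤ α}) ∧
      (∀ c U g, (∀ i : Idx (F.P K), dist1 (fibreFamily U c (pre U c * g * post U c) i) ≤ α) →
          ϑ c U ((avOfRecord F N K k).avg (update U (centralBond c) g) c) = g) ∧
      (∀ c U, ∀ v ∈ T c U, ∀ i : Idx (F.P K), dist1 (fibreFamily U c (pre U c * ϑ c U v * post U c) i) ≤ α) ∧
      (∀ c U v, jd c U v = (jac' c U (ϑ c U v))⁻¹) ∧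
      (∀ c U, ∀ v ∈ T c U, jd c U v ≠ 0) ∧
      (∀ c, Measurable fun p : GaugeField (F.P K) k (SU N) × SU N => jac' c p.1 p.2) ∧
      (∀ c U g, (∀ i : Idx (F.P K), dist1 (fibreFamily U c (pre U c * g * post U c) i) ≤ α) → jac' c U g ≠ 0) ∧
      (∀ c U, (HaarData.haar : Measure (SU N)).restrict
          ((fun g => (avOfRecord F N K k).avg (update U (centralBond c) g) c) ''
            {g : SU N | ∀ i : Idx (F.P K), dist1 (fibreFamily U c (pre U c * g * post U c) i) ≤ α}) =
        (((HaarData.haar : Measure (SU N)).restrict {g : SU N | ∀ i : Idx (F.P K), dist1 (fibreFamily U c (pre U c * g * post U c) i) ≤ α}).withDensity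
            fun g => (jac' c U g : ℝ≥0∞)).map (fun g => (avOfRecord F N K k).avg (update U (centralBond c) g) c)) ∧
      (∀ c U, ContinuousOn (jac' c U) {g : SU N | ∀ i : Idx (F.P K), dist1 (fibreFamily U c (pre U c * g * post U c) i) ≤ α}) ∧
      (∀ c, IsClosed {q : GaugeField (F.P K) k (SU N) × SU N | q.2 ∈ T c q.1}) ∧
      (∀ c, ContinuousOn (fun q : GaugeField (F.P K) k (SU N) × SU N => ϑ c q.1 q.2) {q : GaugeField (F.P K) k (SU N) × SU N | q.2 ∈ T c q.1}) ∧
      ContinuousOn (fun p : (PBond (F.P K) (k + 1) → SU N) × GaugeField (F.P K) k (SU N) =>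
          (extend centralBond (fun c => ϑ c p.2 (p.1 c)) p.2 : GaugeField (F.P K) k (SU N)))
        {p : (PBond (F.P K) (k + 1) → SU N) × GaugeField (F.P K) k (SU N) | ∀ c, p.1 c ∈ T c p.2} ∧
      (∀ c U, IsCompact (T c U)) ∧
      (∀ c U, ContinuousOn (jd c U) (T c U)) ∧
      (∀ c U (g : PBond (F.P K) (k + 1) → SU N), T c (extend centralBond g U) = T c U) ∧
      (∀ c U (g : PBond (F.P K) (k + 1) → SU N), ϑ c (extend centralBond g U) = ϑ c U) ∧
      (∀ c U (g : PBond (F.P K) (k + 1) → SU N), jd c (extend centralBond g U) = jd c U) ∧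
      (∀ c U (g : PBond (F.P K) (k + 1) → SU N), jac' c (extend centralBond g U) = jac' c U) := by
  have hkr : k + 1 ≤ (F.P K).m + (F.P K).K := succ_le_m_add_K hk
  have hβ : Injective (centralBond : PBond (F.P K) (k + 1) → PBond (F.P K) k) := centralBond_injective hkr
  -- the resampling with the private datum `1`
  set e : GaugeField (F.P K) k (SU N) → GaugeField (F.P K) k (SU N) := fun U => extend centralBond (1 : PBond (F.P K) (k + 1) → SU N) U with he
  have hem : Measurable e := measurable_extend_const hβ _
  have hee : ∀ (U : GaugeField (F.P K) k (SU N)) (g : PBond (F.P K) (k + 1) → SU N), e (extend centralBond g U) = e U :=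
    fun U g => extend_extend_eq_extend hβ U _ g
  have hee1 : ∀ U : GaugeField (F.P K) k (SU N), e (e U) = e U := fun U => hee U 1
  have hmap : ∀ (c : PBond (F.P K) (k + 1)) (U : GaugeField (F.P K) k (SU N)) (x : SU N),
      (avOfRecord F N K k).avg (update (e U) (centralBond c) x) c = (avOfRecord F N K k).avg (update U (centralBond c) x) c :=
    fun c U x => avg_update_centralBond_extend hk U c 1 x
  have hwin : ∀ (c : PBond (F.P K) (k + 1)) (U : GaugeField (F.P K) k (SU N)) (g : SU N),
      (∀ i : Idx (F.P K), dist1 (fibreFamily (e U) c (pre (e U) c * g * post (e U) c) i) ≤ α) ↔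
        ∀ i : Idx (F.P K), dist1 (fibreFamily U c (pre U c * g * post U c) i) ≤ α :=
    fun c U g => centralWindow_mem_iff_extend hk c α U 1 g
  have hwinset : ∀ (c : PBond (F.P K) (k + 1)) (U : GaugeField (F.P K) k (SU N)),
      {g : SU N | ∀ i : Idx (F.P K), dist1 (fibreFamily (e U) c (pre (e U) c * g * post (e U) c) i) ≤ α} =
        {g : SU N | ∀ i : Idx (F.P K), dist1 (fibreFamily U c (pre U c * g * post U c) i) ≤ α} :=
    fun c U => centralWindow_extend (N := N) hkr c α U 1
  have hpm : Measurable fun p : GaugeField (F.P K) k (SU N) × SU N => (e p.1, p.2) := (hem.comp measurable_fst).prodMk measurable_snd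
  -- the blind forward density
  set jac' : PBond (F.P K) (k + 1) → GaugeField (F.P K) k (SU N) → SU N → ℝ≥0 := fun c U => jac c (e U) with hjac'
  have hjacm' : ∀ c, Measurable fun p : GaugeField (F.P K) k (SU N) × SU N => jac' c p.1 p.2 := fun c => (hjacm c).comp hpm
  have hjac0' : ∀ c U g, (∀ i : Idx (F.P K), dist1 (fibreFamily U c (pre U c * g * post U c) i) ≤ α) → jac' c U g ≠ 0 :=
    fun c U g hg => hjac0 c (e U) g ((hwin c U g).2 hg)
  have hfwd' : ∀ c U, (HaarData.haar : Measure (SU N)).restrict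
        ((fun g => (avOfRecord F N K k).avg (update U (centralBond c) g) c) ''
          {g : SU N | ∀ i : Idx (F.P K), dist1 (fibreFamily U c (pre U c * g * post U c) i) ≤ α}) =
      (((HaarData.haar : Measure (SU N)).restrict {g : SU N | ∀ i : Idx (F.P K), dist1 (fibreFamily U c (pre U c * g * post U c) i) ≤ α}).withDensity
          fun g => (jac' c U g : ℝ≥0∞)).map (fun g => (avOfRecord F N K k).avg (update U (centralBond c) g) c) :=
    fun c U => forwardLaw_extend hk jac hfwd c U 1
  have hjacc' : ∀ c U, ContinuousOn (jac' c U) {g : SU N | ∀ i : Idx (F.P K), dist1 (fibreFamily U c (pre U c * g * post U c) i) ≤ α} := by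
    intro c U
    have h := hjacc c (e U)
    rw [hwinset c U] at h
    exact h
  -- the sharp packaging at the blind forward density
  obtain ⟨T, ϑ, jd, -, -, hTm, hθm, hjm, hright, hlaw, hTim, hleft, hθwin, hQ, hP, -, -, -, -⟩ :=
    exists_perBondCharts_of_forwardLaws_sharp (F := F) (N := N) hk hα0 hα hαδ hgap jac' hjacm' hjac0' hfwd'
  -- blindify `(T, ϑ, jd)` by pre-composition with `e`
  have hTim' : ∀ c U, T c (e U) = (fun g => (avOfRecord F N K k).avg (update U (centralBond c) g) c) ''
      {g : SU N | ∀ i : Idx (F.P K), dist1 (fibreFamily U c (pre U c * g * post U c) i) ≤ α} := by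
    intro c U
    rw [hTim c (e U), hwinset c U]
    exact image_congr fun x _ => hmap c U x
  have hleft' : ∀ c U g, (∀ i : Idx (F.P K), dist1 (fibreFamily U c (pre U c * g * post U c) i) ≤ α) →
      ϑ c (e U) ((avOfRecord F N K k).avg (update U (centralBond c) g) c) = g := by
    intro c U g hg
    have h := hleft c (e U) g ((hwin c U g).2 hg)
    rwa [hmap c U g] at h
  refine ⟨fun c U => T c (e U), fun c U => ϑ c (e U), fun c U => jd c (e U), jac',
    fun c => (hTm c).preimage hpm, fun c => (hθm c).comp hpm, fun c => (hjm c).comp hpm,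
    fun c U v hv => ?_, fun c U => ?_, hTim', hleft', fun c U v hv => ?_, fun c U v => ?_, fun c U v hv => hP c (e U) v hv,
    hjacm', hjac0', hfwd', hjacc', ?_, ?_, ?_, ?_, ?_, fun c U g => ?_, fun c U g => ?_, fun c U g => ?_, fun c U g => ?_⟩
  · rw [← hmap c U]; exact hright c (e U) v hv
  · rw [← hwinset c U, hlaw c (e U)]
  · exact (hwin c U _).1 (hθwin c (e U) v hv)
  · show jd c (e U) v = (jac c (e U) (ϑ c (e U) v))⁻¹
    rw [hQ c (e U) v]
    show (jac c (e (e U)) (ϑ c (e U) v))⁻¹ = _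
    rw [hee1]
  · exact fun c => isClosed_imageWindowGraph_record hk hαδ _ hTim' c
  · exact fun c => continuousOn_inverse_of_leftInverse_record hk hαδ _ _ hTim' hleft' c
  · exact continuousOn_triChart_of_leftInverse_record hk hαδ _ _ hTim' hleft'
  · exact fun c U => isCompact_imageWindow_record hk hαδ _ hTim' c U
  · refine continuousOn_inverseDensity_of_formula (α := α) _ _ _ jac' (fun c U v => ?_) (fun c U v hv => (hwin c U _).1 (hθwin c (e U) v hv))
      (fun c U => (continuousOn_inverse_of_leftInverse_record hk hαδ _ _ hTim' hleft' c).comp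
        (Continuous.prodMk_right U).continuousOn fun v hv => hv) hjac0' hjacc'
    show jd c (e U) v = (jac c (e U) (ϑ c (e U) v))⁻¹
    rw [hQ c (e U) v]
    show (jac c (e (e U)) (ϑ c (e U) v))⁻¹ = _
    rw [hee1]
  · show T c (e (extend centralBond g U)) = T c (e U)
    rw [hee]
  · show ϑ c (e (extend centralBond g U)) = ϑ c (e U)
    rw [hee]
  · show jd c (e (extend centralBond g U)) = jd c (e U)
    rw [hee]
  · show jac c (e (extend centralBond g U)) = jac c (e U)
    rw [hee]

end Sharp

/-! ## §3  At the record: N09's proved forward laws plugged in -/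

section Record

variable {F : T4Family} {N : ℕ} [NeZero N] {K k : ℕ}

/-- ★★★ **AN EXPLICIT-DENSITY, CONTINUOUS, BLIND CHART OF THE AVERAGING OF RECORD ON THE CENTRAL α-WINDOW — NOTHING DISPLAYED** (`k < K`, `0 ≤ α ≤ 1∕24`, `64α ≤ δ_N`, `157α < L^{−(d−1)}`,
`offCard∕|Idx| + 150α < 1`): §2 fed by dag-n09-w4's (F) `exists_jacobian_forwardLaws_continuousOn`. [cite: Balaban1987RG1, p.259, (0.4) p.253, (2.9)–(2.10) pp.266–267; Kechris1995, Thm 15.1; Helgason2000, Ch. I §1 Thm. 1.14 (12)-(13) p. 96] -/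
theorem exists_blindSharpPerBondCharts_centralWindow_record (hk : k < K) {α : ℝ} (hα0 : 0 ≤ α) (hα : α ≤ 1 / 24) (hα64 : 64 * α ≤ deltaSU (Fin N))
    (hαL : 157 * α < (((F.P K).L : ℝ) ^ ((F.P K).d - 1))⁻¹)
    (hgap : ∀ c : PBond (F.P K) (k + 1), (offCard c : ℝ) / (Fintype.card (Idx (F.P K)) : ℝ) + 150 * α < 1) :
    ∃ (T : PBond (F.P K) (k + 1) → GaugeField (F.P K) k (SU N) → Set (SU N))
      (ϑ : PBond (F.P K) (k + 1) → GaugeField (F.P K) k (SU N) → SU N → SU N)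
      (jd jac' : PBond (F.P K) (k + 1) → GaugeField (F.P K) k (SU N) → SU N → ℝ≥0),
      (∀ c, MeasurableSet {p : GaugeField (F.P K) k (SU N) × SU N | p.2 ∈ T c p.1}) ∧
      (∀ c, Measurable fun p : GaugeField (F.P K) k (SU N) × SU N => ϑ c p.1 p.2) ∧
      (∀ c, Measurable fun p : GaugeField (F.P K) k (SU N) × SU N => jd c p.1 p.2) ∧
      (∀ c U, ∀ v ∈ T c U, (avOfRecord F N K k).avg (update U (centralBond c) (ϑ c U v)) c = v) ∧
      (∀ c U, (HaarData.haar : Measure (SU N)).restrict {g : SU N | ∀ i : Idx (F.P K), dist1 (fibreFamily U c (pre U c * g * post U c) i) ≤ α} =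
        (((HaarData.haar : Measure (SU N)).restrict (T c U)).withDensity fun v => (jd c U v : ℝ≥0∞)).map (ϑ c U)) ∧
      (∀ c U, T c U = (fun g => (avOfRecord F N K k).avg (update U (centralBond c) g) c) ''
          {g : SU N | ∀ i : Idx (F.P K), dist1 (fibreFamily U c (pre U c * g * post U c) i) ≤ α}) ∧
      (∀ c U g, (∀ i : Idx (F.P K), dist1 (fibreFamily U c (pre U c * g * post U c) i) ≤ α) →
          ϑ c U ((avOfRecord F N K k).avg (update U (centralBond c) g) c) = g) ∧
      (∀ c U, ∀ v ∈ T c U, ∀ i : Idx (F.P K), dist1 (fibreFamily U c (pre U c * ϑ c U v * post U c) i) ≤ α) ∧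
      (∀ c U v, jd c U v = (jac' c U (ϑ c U v))⁻¹) ∧
      (∀ c U, ∀ v ∈ T c U, jd c U v ≠ 0) ∧
      (∀ c, Measurable fun p : GaugeField (F.P K) k (SU N) × SU N => jac' c p.1 p.2) ∧
      (∀ c U g, (∀ i : Idx (F.P K), dist1 (fibreFamily U c (pre U c * g * post U c) i) ≤ α) → jac' c U g ≠ 0) ∧
      (∀ c U, (HaarData.haar : Measure (SU N)).restrict
          ((fun g => (avOfRecord F N K k).avg (update U (centralBond c) g) c) ''
            {g : SU N | ∀ i : Idx (F.P K), dist1 (fibreFamily U c (pre U c * g * post U c) i) ≤ α}) =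
        (((HaarData.haar : Measure (SU N)).restrict {g : SU N | ∀ i : Idx (F.P K), dist1 (fibreFamily U c (pre U c * g * post U c) i) ≤ α}).withDensity
            fun g => (jac' c U g : ℝ≥0∞)).map (fun g => (avOfRecord F N K k).avg (update U (centralBond c) g) c)) ∧
      (∀ c U, ContinuousOn (jac' c U) {g : SU N | ∀ i : Idx (F.P K), dist1 (fibreFamily U c (pre U c * g * post U c) i) ≤ α}) ∧
      (∀ c, IsClosed {q : GaugeField (F.P K) k (SU N) × SU N | q.2 ∈ T c q.1}) ∧
      (∀ c, ContinuousOn (fun q : GaugeField (F.P K) k (SU N) × SU N => ϑ c q.1 q.2) {q : GaugeField (F.P K) k (SU N) × SU N | q.2 ∈ T c q.1}) ∧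
      ContinuousOn (fun p : (PBond (F.P K) (k + 1) → SU N) × GaugeField (F.P K) k (SU N) =>
          (extend centralBond (fun c => ϑ c p.2 (p.1 c)) p.2 : GaugeField (F.P K) k (SU N)))
        {p : (PBond (F.P K) (k + 1) → SU N) × GaugeField (F.P K) k (SU N) | ∀ c, p.1 c ∈ T c p.2} ∧
      (∀ c U, IsCompact (T c U)) ∧
      (∀ c U, ContinuousOn (jd c U) (T c U)) ∧
      (∀ c U (g : PBond (F.P K) (k + 1) → SU N), T c (extend centralBond g U) = T c U) ∧
      (∀ c U (g : PBond (F.P K) (k + 1) → SU N), ϑ c (extend centralBond g U) = ϑ c U) ∧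
      (∀ c U (g : PBond (F.P K) (k + 1) → SU N), jd c (extend centralBond g U) = jd c U) ∧
      (∀ c U (g : PBond (F.P K) (k + 1) → SU N), jac' c (extend centralBond g U) = jac' c U) := by
  have hαδ : α < deltaSU (Fin N) := by have := ExpMeanLog.deltaSU_pos (n := Fin N); linarith
  obtain ⟨jac, hjacm, hjac0, hfwd, hjacc⟩ :=
    exists_jacobian_forwardLaws_continuousOn (N := N) (P := F.P K) (succ_le_m_add_K hk) hα0 hα hα64 hαL hgap
  have hfwd' : ∀ c U, (HaarData.haar : Measure (SU N)).restrict
        ((fun g => (avOfRecord F N K k).avg (update U (centralBond c) g) c) ''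
          {g : SU N | ∀ i : Idx (F.P K), dist1 (fibreFamily U c (pre U c * g * post U c) i) ≤ α}) =
      (((HaarData.haar : Measure (SU N)).restrict {g : SU N | ∀ i : Idx (F.P K), dist1 (fibreFamily U c (pre U c * g * post U c) i) ≤ α}).withDensity
          fun g => (jac c U g : ℝ≥0∞)).map (fun g => (avOfRecord F N K k).avg (update U (centralBond c) g) c) := by
    intro c U
    have h := hfwd c U
    rw [← avOfRecord_avg] at h
    exact h
  exact exists_blindSharpPerBondCharts_centralWindow hk hα0 hα hαδ hgap jac hjacm hjac0 hfwd' hjacc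

end Record

end Summit.QuantumFields.YangMills.Theorems.BalabanUVNodesPortS1

end
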